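import Literature.NumberTheory.Adeles.CompactSubgroupStabilisesLattice
import HarnessLib

/-!
# Saturating a stable lattice: integrality of conjugates is inherited by sums of commuting images

Matrix form of the following lattice fact [cite: PlatonovRapinchuk1994, §8.1]: if an adelic matrix
`X ∈ GL_N(𝔸_{ℚ,f})` stabilises the lattice `Λ = γ⁻¹ ℤ^N` (i.e. `γ X γ⁻¹` has entries in `ℤ̂`) and
`A₁, …, A_r ∈ M_N(ℚ)` commute with `X`, then `X` stabilises every full lattice of the form
`Λ′ = Σᵢ Aᵢ Λ = γ′⁻¹ ℤ^N`: in coordinates, `γ′⁻¹ = Σᵢ Aᵢ γ⁻¹ Bᵢ` and `Aᵢ γ⁻¹ = γ′⁻¹ Dᵢ` with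
integer matrices `Bᵢ, Dᵢ` (the columns of `γ′⁻¹` are `ℤ`-combinations of those of the `Aᵢ γ⁻¹`, and
conversely), whence `γ′ X γ′⁻¹ = Σᵢ Dᵢ (γ X γ⁻¹) Bᵢ` is again `ℤ̂`-integral.  This is the brick that
upgrades the lattice produced by ★ `exists_rat_conj_entries_mem_integralFiniteAdeles` to an
`𝓞`-stable / split saturation without losing stability.
-/

noncomputable section

open scoped Matrix
open NumberField IsDedekindDomain Matrix
open Literature.NumberTheory.Automorphic (integralFiniteAdeles)
open Literature.AlgebraicGeometry.ModuliOfAbelianVarieties (finAdeleQ)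

namespace Literature.NumberTheory.Adeles

variable {N : Type} [Fintype N] {ι : Type} [Fintype ι]

/-- Entries of `Σᵢ Dᵢ · Y · Bᵢ` are `ℤ̂`-integral when those of `Y` are and `Bᵢ, Dᵢ` are integer
matrices. [cite: PlatonovRapinchuk1994, §8.1] -/
theorem forall_mem_integral_sum_intConj (D B : ι → Matrix N N ℤ) {Y : Matrix N N finAdeleQ}
    (hY : ∀ i k, Y i k ∈ integralFiniteAdeles ℚ) :
    ∀ i k, (∑ l, (D l).map (Int.cast : ℤ → finAdeleQ) * Y * (B l).map (Int.cast : ℤ → finAdeleQ)) i k ∈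
      integralFiniteAdeles ℚ := by
  intro i k
  rw [Matrix.sum_apply]
  refine sum_mem fun l _ => ?_
  rw [Matrix.mul_apply]
  refine sum_mem fun a _ => mul_mem ?_ (intCast_mem _ _)
  rw [Matrix.mul_apply]
  exact sum_mem fun a' _ => mul_mem (intCast_mem _ _) (hY a' a)

/-- A matrix commuting with an invertible matrix commutes with its inverse.
[cite: PlatonovRapinchuk1994, §8.1] -/
theorem map_mul_inv_eq_of_comm [DecidableEq N] (A : Matrix N N finAdeleQ) (X : GL N finAdeleQ)
    (h : A * (X : Matrix N N finAdeleQ) = (X : Matrix N N finAdeleQ) * A) :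
    A * ((X⁻¹ : GL N finAdeleQ) : Matrix N N finAdeleQ) = ((X⁻¹ : GL N finAdeleQ) : Matrix N N finAdeleQ) * A := by
  have hX : ((X⁻¹ : GL N finAdeleQ) : Matrix N N finAdeleQ) * (X : Matrix N N finAdeleQ) = 1 := by
    rw [← Units.val_mul, inv_mul_cancel, Units.val_one]
  have hX' : (X : Matrix N N finAdeleQ) * ((X⁻¹ : GL N finAdeleQ) : Matrix N N finAdeleQ) = 1 := by
    rw [← Units.val_mul, mul_inv_cancel, Units.val_one]
  calc A * ((X⁻¹ : GL N finAdeleQ) : Matrix N N finAdeleQ)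
      = ((X⁻¹ : GL N finAdeleQ) : Matrix N N finAdeleQ) * (X : Matrix N N finAdeleQ) * A *
          ((X⁻¹ : GL N finAdeleQ) : Matrix N N finAdeleQ) := by rw [hX, Matrix.one_mul]
    _ = ((X⁻¹ : GL N finAdeleQ) : Matrix N N finAdeleQ) * (A * (X : Matrix N N finAdeleQ)) *
          ((X⁻¹ : GL N finAdeleQ) : Matrix N N finAdeleQ) := by rw [h, Matrix.mul_assoc _ _ A]
    _ = ((X⁻¹ : GL N finAdeleQ) : Matrix N N finAdeleQ) * A := by
          rw [Matrix.mul_assoc, Matrix.mul_assoc, hX', Matrix.mul_one]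

/-- **Saturation brick.**  Let `γ, γ′ ∈ GL_N(ℚ)`, `X` an adelic `N × N` matrix with
`γ_𝔸 X γ_𝔸⁻¹` integral, and `Aᵢ ∈ M_N(ℚ)` commuting with `X`; if `γ′⁻¹ = Σᵢ Aᵢ γ⁻¹ Bᵢ` and
`Aᵢ γ⁻¹ = γ′⁻¹ Dᵢ` with integer matrices `Bᵢ, Dᵢ` (i.e. `γ′⁻¹ℤ^N = Σᵢ Aᵢ γ⁻¹ ℤ^N` as lattices), then
`γ′_𝔸 X γ′_𝔸⁻¹ = Σᵢ Dᵢ (γ_𝔸 X γ_𝔸⁻¹) Bᵢ` is integral. [cite: PlatonovRapinchuk1994, §8.1] -/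
theorem forall_mem_integral_conj_of_sum [DecidableEq N] (γ γ' : GL N ℚ) (X : Matrix N N finAdeleQ)
    (A : ι → Matrix N N ℚ) (B D : ι → Matrix N N ℤ)
    (hcomm : ∀ l, (A l).map (algebraMap ℚ finAdeleQ) * X = X * (A l).map (algebraMap ℚ finAdeleQ))
    (hγ' : ((γ'⁻¹ : GL N ℚ) : Matrix N N ℚ) =
      ∑ l, A l * ((γ⁻¹ : GL N ℚ) : Matrix N N ℚ) * (B l).map (Int.cast : ℤ → ℚ))
    (hD : ∀ l, A l * ((γ⁻¹ : GL N ℚ) : Matrix N N ℚ) =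
      ((γ'⁻¹ : GL N ℚ) : Matrix N N ℚ) * (D l).map (Int.cast : ℤ → ℚ))
    (hX : ∀ i k, ((γ : Matrix N N ℚ).map (algebraMap ℚ finAdeleQ) * X *
      ((γ⁻¹ : GL N ℚ) : Matrix N N ℚ).map (algebraMap ℚ finAdeleQ)) i k ∈ integralFiniteAdeles ℚ) :
    ∀ i k, ((γ' : Matrix N N ℚ).map (algebraMap ℚ finAdeleQ) * X *
      ((γ'⁻¹ : GL N ℚ) : Matrix N N ℚ).map (algebraMap ℚ finAdeleQ)) i k ∈ integralFiniteAdeles ℚ := by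
  classical
  -- notation over `𝔸`
  set φ : Matrix N N ℚ →+* Matrix N N finAdeleQ := (algebraMap ℚ finAdeleQ).mapMatrix with hφ
  have hφapp : ∀ Z : Matrix N N ℚ, Z.map (algebraMap ℚ finAdeleQ) = φ Z := fun Z => rfl
  have hφint : ∀ Z : Matrix N N ℤ, φ (Z.map (Int.cast : ℤ → ℚ)) = Z.map (Int.cast : ℤ → finAdeleQ) := by
    intro Z
    rw [← hφapp, Matrix.map_map]
    ext i k
    simp only [Matrix.map_apply, Function.comp_apply, map_intCast]
  have hPP' : φ ((γ⁻¹ : GL N ℚ) : Matrix N N ℚ) * φ (γ : Matrix N N ℚ) = 1 := by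
    rw [← map_mul, ← Units.val_mul, inv_mul_cancel, Units.val_one, map_one]
  have hQQ' : φ (γ' : Matrix N N ℚ) * φ ((γ'⁻¹ : GL N ℚ) : Matrix N N ℚ) = 1 := by
    rw [← map_mul, ← Units.val_mul, mul_inv_cancel, Units.val_one, map_one]
  rw [hφapp, hφapp] at hX ⊢
  -- `γ′ X γ′⁻¹ = Σ Dᵢ (γ X γ⁻¹) Bᵢ`
  have key : φ (γ' : Matrix N N ℚ) * X * φ ((γ'⁻¹ : GL N ℚ) : Matrix N N ℚ) =
      ∑ l, (D l).map (Int.cast : ℤ → finAdeleQ) *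
        (φ (γ : Matrix N N ℚ) * X * φ ((γ⁻¹ : GL N ℚ) : Matrix N N ℚ)) *
          (B l).map (Int.cast : ℤ → finAdeleQ) := by
    rw [hγ', map_sum, Matrix.mul_sum]
    refine Finset.sum_congr rfl fun l _ => ?_
    rw [map_mul, map_mul, hφint, ← hφapp (A l)]
    have hDl : φ (γ' : Matrix N N ℚ) * (A l).map (algebraMap ℚ finAdeleQ) *
        φ ((γ⁻¹ : GL N ℚ) : Matrix N N ℚ) = (D l).map (Int.cast : ℤ → finAdeleQ) := by
      rw [hφapp, Matrix.mul_assoc, ← map_mul, hD l, map_mul, ← Matrix.mul_assoc, hQQ', Matrix.one_mul,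
        hφint]
    calc φ (γ' : Matrix N N ℚ) * X * ((A l).map (algebraMap ℚ finAdeleQ) *
          φ ((γ⁻¹ : GL N ℚ) : Matrix N N ℚ) * (B l).map (Int.cast : ℤ → finAdeleQ))
        = φ (γ' : Matrix N N ℚ) * (X * (A l).map (algebraMap ℚ finAdeleQ)) *
          φ ((γ⁻¹ : GL N ℚ) : Matrix N N ℚ) * (B l).map (Int.cast : ℤ → finAdeleQ) := by
          simp only [Matrix.mul_assoc]
      _ = φ (γ' : Matrix N N ℚ) * (A l).map (algebraMap ℚ finAdeleQ) *
          φ ((γ⁻¹ : GL N ℚ) : Matrix N N ℚ) *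
          (φ (γ : Matrix N N ℚ) * X * φ ((γ⁻¹ : GL N ℚ) : Matrix N N ℚ)) *
          (B l).map (Int.cast : ℤ → finAdeleQ) := by
          rw [← hcomm l]
          simp only [Matrix.mul_assoc]
          rw [← Matrix.mul_assoc (φ ((γ⁻¹ : GL N ℚ) : Matrix N N ℚ)) (φ (γ : Matrix N N ℚ)), hPP',
            Matrix.one_mul]
      _ = (D l).map (Int.cast : ℤ → finAdeleQ) *
          (φ (γ : Matrix N N ℚ) * X * φ ((γ⁻¹ : GL N ℚ) : Matrix N N ℚ)) *
          (B l).map (Int.cast : ℤ → finAdeleQ) := by rw [hDl]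
  rw [key]
  exact forall_mem_integral_sum_intConj D B hX

end Literature.NumberTheory.Adeles

end
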